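import Summits.CriticalPhenomena.CardyFormulaZ2.Theses.CardySusyWard

/-!
# Sketch — crux ideas for `CardySusyWard.ParafermionFamiliesToSLESix` (stmt-CriticalPhenomena-10814)

First lemmas of the idea card `strip-anchored-vertex-normalisation` (crux-ideate round 1, ideator 2).
Nothing here is a route item; statements only need to elaborate (`lean check` rc 0).
-/

noncomputable section

open scoped Classical
open Literature.Probability.LatticeModels Literature.Probability.Percolation
open Literature.Probability.RandomPlanarGeometry

namespace Summit.CriticalPhenomena.CardyFormulaZ2.Cruxes.ParafermionFamiliesToSLESix.Sketch

/-- The contribution of one medial path `γ` (mesh `δ`, spin `spin`) to the CORNER (= medial-edge)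
parafermionic observable at the corner `(v, f)`: the sum over the positions `k` at which `γ`
traverses the oriented medial edge `cornerSource v f → cornerTarget v f` of
`exp (-i · spin · W)`, `W` the winding of the polyline prefix ending with that edge
(the convention of `CardyComplexCone`'s edge observable `E_δ(v,f)`). -/
def cornerPassageSum (γ : List MedialVertex) (δ spin : ℝ) (v f : Site 2) : ℂ :=
  ∑ k ∈ (Finset.range γ.length).filter
      (fun k => γ[k]? = some (cornerSource v f) ∧ γ[k + 1]? = some (cornerTarget v f)),
    Complex.exp (-Complex.I * spin * ((winding ((γ.map (medialPoint δ)).take (k + 2)) : ℝ) : ℂ))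

/-- **First lemma (VertexCornerBridge).** For a medial exploration path `γ` of admissible-type
data (every consecutive pair is an oriented corner, every turn is `±π/2`) and every medial vertex
`z` other than the two `A`–`B` edges, the spin-`1/3` VERTEX observable of the tree
(`passageSum`, winding = average of arrival and departure windings) is an exact multiple of the
sum of the CORNER observables over the (at most four) corners entering or leaving `z`:
`2 cos(π/12) · passageSum γ δ (1/3) z = Σ_{c ∋ z} cornerPassageSum γ δ (1/3) c`.
Reason: a passage at `z` with arrival winding `W` and turn `±π/2` contributes
`e^{-iW/3} + e^{-i(W ± π/2)/3} = 2cos(π/12) · e^{-i(W ± π/4)/3}`. Consequently the vertex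
observable inherits every LINEAR identity of the corner observable (half-CR flux / Green
identity `sum_halfCRForm_eq_halfCRFlux`, strip conservation law, wall anchoring). -/
def VertexCornerBridge : Prop :=
  ∀ (E : DiscreteDobrushin) (ω : BondConfig (Site 2)) (γ : List MedialVertex),
    IsMedialExploration E ω γ → 0 < E.δ → ∀ z : MedialVertex, z ∉ E.zdABEdges →
      (((2 * Real.cos (Real.pi / 12) : ℝ) : ℂ)) * passageSum γ E.δ (1 / 3) z =
        ∑ᶠ c : Site 2 × Site 2,
          (if IsCorner c.1 c.2 ∧ (cornerSource c.1 c.2 = z ∨ cornerTarget c.1 c.2 = z)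
            then cornerPassageSum γ E.δ (1 / 3) c.1 c.2 else 0)

/-- The expected spin-`1/3` vertex observable of the family `Λ` at mesh `δ` and medial vertex `z`
(the quantity of `CardySusyWard.WeakHolomorphy` / `ParafermionPrecompact`). -/
def obs (Λ : ℝ → DiscreteDobrushin) (δ : ℝ) (z : MedialVertex) : ℂ :=
  ∫ ω, passageSum (medialExploration (Λ δ) ω) δ (1 / 3) z ∂(bondPercolation (zdGraph 2) half)

/-- The six unbundled `ZdDiscretisationFamily` fields used by the route's items. -/
def IsGoodFamily (D : DobrushinDomain) (Λ : ℝ → DiscreteDobrushin) : Prop :=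
  (∀ δ, (Λ δ).Ω = D.carrier) ∧ (∀ δ, (Λ δ).δ = δ) ∧
    Filter.Tendsto (fun δ : ℝ => Metric.hausdorffEDist (Λ δ).arcA (D.arc 0))
      (nhdsWithin (0:ℝ) (Set.Ioi 0)) (nhds 0) ∧
    Filter.Tendsto (fun δ : ℝ => Metric.hausdorffEDist (Λ δ).arcB (D.arc 1))
      (nhdsWithin (0:ℝ) (Set.Ioi 0)) (nhds 0) ∧
    Filter.Tendsto (fun δ : ℝ => Metric.hausdorffEDist (medialPoint δ '' (Λ δ).zdABEdges) {D.pt 0, D.pt 1})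
      (nhdsWithin (0:ℝ) (Set.Ioi 0)) (nhds 0) ∧
    (∀ᶠ δ in nhdsWithin (0:ℝ) (Set.Ioi 0), (Λ δ).IsZdAdmissible)

/-- **Output of the strip anchor (N, in the shape every line of this crux needs).**
Some Dobrushin domain (a long — axis-parallel or diagonal — rectangle), some good family and some
compact inside carry the vertex observable at the sharp scale: `‖obs‖ ≥ c δ^{1/3}` at SOME lattice
edge of the compact, for ALL small meshes. This is the negation, in strong (eventually-in-δ)
form, of the zero world `δ^{-1/3} F_δ → 0` to which `ParafermionPrecompact` collapses as typed
(refuter `Evidence.lean`, `SusyWard.parafermionPrecompact_iff_vanishing`). -/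
def NonVanishingSomewhere : Prop :=
  ∃ (D : DobrushinDomain) (Λ : ℝ → DiscreteDobrushin), IsGoodFamily D Λ ∧
    ∃ K : Set ℂ, IsCompact K ∧ K ⊆ D.carrier ∧ ∃ c : ℝ, 0 < c ∧
      ∀ᶠ δ in nhdsWithin (0:ℝ) (Set.Ioi 0), ∃ z : MedialVertex,
        z ∈ (zdGraph 2).edgeSet ∧ medialPoint δ z ∈ K ∧ c * δ ^ ((1:ℝ) / 3) ≤ ‖obs Λ δ z‖

/-- The as-typed shortcut, recorded honestly: while `ParafermionPrecompact` (stmt-11293) keeps its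
unguarded clause (ii), it is equivalent to the zero world, so `NonVanishingSomewhere` refutes it
and the crux holds vacuously. The first arrow is the refuter's certified collapse
(`parafermionPrecompact_iff_vanishing`) composed with the definition of `NonVanishingSomewhere`;
it is stated, not assumed, and becomes moot once 11293 is edge-guarded. -/
def TypedCollapse : Prop :=
  NonVanishingSomewhere → ¬ Summit.CriticalPhenomena.CardyFormulaZ2.Theses.CardySusyWard.ParafermionPrecompact

/-- Pure logic: the typed crux from the collapse and the anchor (no percolation content). -/
theorem crux_of_typedCollapse (h₁ : TypedCollapse) (h₂ : NonVanishingSomewhere) :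
    Summit.CriticalPhenomena.CardyFormulaZ2.Theses.CardySusyWard.ParafermionFamiliesToSLESix :=
  fun _ hP => ((h₁ h₂) hP).elim

end Summit.CriticalPhenomena.CardyFormulaZ2.Cruxes.ParafermionFamiliesToSLESix.Sketch

end
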